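import Summits.BirchSwinnertonDyer.BirchSwinnertonDyer.Theorems.PrintCFramJZeroThreeTrivialCharRegime
import Literature.NumberTheory.EllipticCurves.PadicLogNormProofs
import Literature.NumberTheory.QuadraticFields.IntegralBasisConjugation
import Literature.NumberTheory.QuadraticFields.ClassNumberOne
import Literature.NumberTheory.QuadraticFields.KroneckerSplitting
import Literature.NumberTheory.QuadraticFields.HeegnerCondition
import HarnessLib

/-!
# Kriz–Li Thm. 7.1 (ψ = 1) at `p = 3` for the Heegner field `K = ℚ(√−2)`: hypothesis (4) IN THE KERNEL
(cell `bsd-print-cfram`, seat p3 g3; PLAN v4 §2 p3 (b) «243a K-certificate»; `--supports` item T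
`PrintCFram.LocalThreeTorsionBSDThree` = stmt-BirchSwinnertonDyer-20699)

p3 g2's class theorem `bsdp_three_of_thm71_trivialChar` (`PrintCFramJZeroThreeTrivialCharRegime.lean`, class
`243a`, `N = 3⁵`) displays ONE numeric certificate: Kriz–Li's hypothesis (4)
`‖((p − 1)/(2p)) · log_p ᾱ‖ = 1` for `(α) = 𝔭^{h_K}`, `𝔭 ∣ 3` the prime under `ιp : K → ℚ₃`, `ᾱ = τ α`.
This file DISCHARGES it for every imaginary quadratic `K` with `d_K = −8` (`K ≅ ℚ(√−2)`, the
Heegner field of record for `243a`: `3` splits, `h_K = 1`), by elementary algebra: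

* §1 `norm_third_mul_padicLog_eq_one_of_trace_norm` — in `ℚ₃`: `a + u = T`, `T² = 4`, `a u = 3`,
  `‖a‖ < 1` ⟹ `u` is a unit with `u² − 1 = −T a`, so `‖log₃ u‖ = ‖u² − 1‖ = 3⁻¹` (the tree's
  `norm_padicLog_eq_norm_unitPart_pow_sub_one`) and `‖(2/6) · log₃ u‖ = 1`;
* §2 `d_K = −8`: `h_K = 1` (tree `isPrincipalIdealRing_of_sq_eq_intCast`), `3` splits
  (`J(−8 | 3) = 1`, tree `ncard_primesOver_eq_two_iff_jacobiSym`), and a generator `α = u + v√−2`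
  of a prime above `3` has `u² + 2v² = N(α) = 3`, so `u, v = ±1`, `α ᾱ = 3`, `α + ᾱ = 2u = ±2`
  (tree `TauData`: integral basis `(1, τ)`, `τ² = −2`, conjugation `σ`, `N(x) = x σx`); the
  non-trivial automorphism `τ ≠ 1` IS `σ` (`#Aut(K/ℚ) = 2`);
* §3 `thm71_four_of_discr_eq_neg_eight` — hypothesis (4) as printed in the class theorem;
* §4 `bsdp_three_of_thm71_trivialChar_discr_neg_eight` — the `243a` class theorem with `K` of
  discriminant `−8`: (4), `d_K < −4`, `3` split, `α`, `τ` DISCHARGED / CONSTRUCTED; displayed remain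
  only Route U's data + PUB facts + twin + level-`0` generator + `(𝔭, h𝔭, hιp)` = "𝔭 is the prime
  under `ιp`" (canonical data, no certificate).

Hand check (REF S20-pre, v₃(log₃ ᾱ) = 1 for d_K = −8): `ιp(√−2) ≡ 5 (mod 9)` on the branch with
`ιp(1 + √−2) ∈ 3ℤ₃`, `ᾱ = 1 − √−2 ↦ 5`, `5² = 25 ≢ 1 (mod 9)`.  beyond-print: NO (arithmetic of
`ℚ(√−2)` and of `log₃`; the printed theorem is Kriz–Li 7.1).
References: [KrizLi2019] Thm. 7.1 second alternative (pp. 42–43), Rem. 7.2; [Marcus2018] Ch. 2–3, 5;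
[Iwasawa1972PadicL] §4.4.
-/

set_option linter.dupNamespace false
set_option autoImplicit false

noncomputable section

open scoped Classical
open NumberField WeierstrassCurve IsDedekindDomain
open Literature.NumberTheory.EllipticCurves Literature.NumberTheory.EllipticCurves.KrizLi2019
  Literature.NumberTheory.EllipticCurves.ModularForms Literature.NumberTheory.EllipticCurves.Rank1Residual
  Literature.NumberTheory.QuadraticFields Literature.NumberTheory.QuadraticFields.Quadratic
  Summit.BirchSwinnertonDyer.Rank1Residual.X12.O11 Summit.BirchSwinnertonDyer.Rank1Residual.X12.O11.RouteU

namespace Summit.BirchSwinnertonDyer.BirchSwinnertonDyer.Theorems.PrintCFram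

/-! ## §1 The `3`-adic valuation lemma -/

/-- **`‖(2/6)·log₃ u‖₃ = 1` for the conjugate root.** In `ℚ₃`: if `a + u = T`, `T² = 4`, `a u = 3`
and `‖a‖ < 1`, then `‖((3 − 1)/(2·3)) · log₃ u‖ = 1`. Proof: `‖T‖ = 1`, `u = T − a` is a unit,
`‖a‖ = ‖3‖/‖u‖ = 3⁻¹`, `u² − 1 = Tu − 4 = T(u − T) = −Ta` has norm `3⁻¹`, and
`‖log₃ u‖ = ‖u² − 1‖` for a `3`-adic unit (Iwasawa logarithm, tree
`norm_padicLog_eq_norm_unitPart_pow_sub_one`). [cite: Iwasawa1972PadicL, §4.4] -/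
theorem norm_third_mul_padicLog_eq_one_of_trace_norm {a u T : ℚ_[3]} (hT : T ^ 2 = 4)
    (hsum : a + u = T) (hprod : a * u = 3) (ha : ‖a‖ < 1) :
    ‖(((3 : ℕ) : ℚ_[3]) - 1) / (2 * (3 : ℕ)) * padicLog 3 u‖ = 1 := by
  -- `‖T‖ = 1`
  have hT1 : ‖T‖ = 1 := by
    have h4 : ‖(4 : ℚ_[3])‖ = 1 := by
      have : ((4 : ℕ) : ℚ_[3]) = 4 := by norm_num
      rw [← this, Padic.norm_natCast_eq_one_iff]; decide
    have := congrArg (‖·‖) hT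
    simp only [norm_pow, h4] at this
    nlinarith [norm_nonneg T]
  -- `‖u‖ = 1`
  have hu : u = T - a := by linear_combination hsum
  have hu1 : ‖u‖ = 1 := by
    rw [hu, sub_eq_add_neg, Padic.add_eq_max_of_ne (by rw [hT1, norm_neg]; exact ha.ne'), hT1,
      norm_neg]
    exact max_eq_left ha.le
  have hu0 : u ≠ 0 := by rw [← norm_pos_iff, hu1]; norm_num
  -- `‖a‖ = 1/3`
  have ha3 : ‖a‖ = 3⁻¹ := by
    have := congrArg (‖·‖) hprod
    simp only [norm_mul, hu1, mul_one] at this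
    rw [this]
    have : ((3 : ℕ) : ℚ_[3]) = 3 := by norm_num
    rw [← this, Padic.norm_p]; norm_num
  -- `u² − 1 = −T a`
  have hsq : u ^ 2 - 1 = -(T * a) := by linear_combination (u + T) * hsum - hprod + hT
  -- valuation of `u` is `0`
  have hval : u.valuation = 0 := by
    have h := Padic.norm_eq_zpow_neg_valuation hu0
    rw [hu1] at h
    have h' := zpow_right_injective₀ (by norm_num : (0:ℝ) < 3) (by norm_num : (3:ℝ) ≠ 1)
      (h.symm.trans (zpow_zero _).symm)
    omega
  have hlog : ‖padicLog 3 u‖ = 3⁻¹ := by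
    rw [norm_padicLog_eq_norm_unitPart_pow_sub_one (p := 3) (by decide) hu0, hval, neg_zero, zpow_zero,
      mul_one, show (3 : ℕ) - 1 = 2 from rfl, hsq, norm_neg, norm_mul, hT1, ha3, one_mul]
  have hc : ‖(((3 : ℕ) : ℚ_[3]) - 1) / (2 * (3 : ℕ))‖ = 3 := by
    have h3 : ‖(3 : ℚ_[3])‖ = 3⁻¹ := by
      have : ((3 : ℕ) : ℚ_[3]) = 3 := by norm_num
      rw [← this, Padic.norm_p]; norm_num
    push_cast
    rw [show ((3 : ℚ_[3]) - 1) / (2 * 3) = 3⁻¹ by norm_num, norm_inv, h3, inv_inv]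
  rw [norm_mul, hc, hlog]; norm_num

/-! ## §2 Imaginary quadratic fields of discriminant `−8` -/

section MinusEight

variable {K : Type} [Field K] [NumberField K]

/-- **`h_K = 1` for `d_K = −8`** (`K ≅ ℚ(√−2)`; `s² = d_K = −8` for the tree's integral-basis datum,
and the tree's `isPrincipalIdealRing_of_sq_eq_intCast` (Minkowski)). [cite: Marcus2018, Ch. 5 (after Cor. 2 of Thm. 37)] -/
theorem classNumber_eq_one_of_discr_eq_neg_eight (hK : IsImaginaryQuadratic K)
    (hdK : NumberField.discr K = -8) : NumberField.classNumber K = 1 := by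
  obtain ⟨T⟩ := nonempty_tauData (K := K) hK.1
  have hs : ((T.s : 𝓞 K) : K) ^ 2 = ((-8 : ℤ) : K) := by rw [T.sq_s, hdK]
  haveI := isPrincipalIdealRing_of_sq_eq_intCast hK.1 hs (by decide)
  exact NumberField.classNumber_eq_one_iff.mpr ‹_›

/-- **`3` splits in `K` when `d_K = −8`** (`J(−8 | 3) = J(1 | 3) = 1`; tree decomposition law
`ncard_primesOver_eq_two_iff_jacobiSym`). [cite: Marcus2018, Ch. 3, Thm. 25] -/
theorem ncard_primesOver_three_eq_two_of_discr_eq_neg_eight (hK : IsImaginaryQuadratic K)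
    (hdK : NumberField.discr K = -8) :
    ((Ideal.span {((3 : ℕ) : ℤ)}).primesOver (𝓞 K)).ncard = 2 := by
  rw [ncard_primesOver_eq_two_iff_jacobiSym hK.1 Nat.prime_three (by norm_num), hdK,
    jacobiSym.mod_left, show (-8 : ℤ) % ((3 : ℕ) : ℤ) = 1 by norm_num, jacobiSym.one_left]

/-- **Generators of a prime above `3` in `ℚ(√−2)`**: if `d_K = −8`, `𝔭 ∣ 3` and `(α) = 𝔭`, then in the
integral basis `(1, τ)` (`τ² = −2`) one has `α = u + vτ` with `u² = v² = 1`; whence `α·σα = 3` and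
`α + σα = 2u` with `(2u)² = 4` (`σ` the conjugation). [cite: Marcus2018, Ch. 3, Thm. 22 (norm of a principal ideal)] -/
theorem exists_coords_of_span_eq_prime_three (hK : IsImaginaryQuadratic K)
    (hdK : NumberField.discr K = -8) (T : TauData K) {𝔭 : Ideal (𝓞 K)}
    (h𝔭 : 𝔭 ∈ (Ideal.span {((3 : ℕ) : ℤ)}).primesOver (𝓞 K)) {α : 𝓞 K} (hα : Ideal.span {α} = 𝔭) :
    ∃ u v : ℤ, α = (u : 𝓞 K) + (v : 𝓞 K) * T.τ ∧ u ^ 2 = 1 ∧ v ^ 2 = 1 ∧ T.ε = 0 ∧ T.m = -2 := by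
  have h2 := hK.1
  have hε01 := T.ε_eq
  have hdisc := T.discr_eq
  have hε : T.ε = 0 := by omega
  have hm : T.m = -2 := by omega
  -- `N(𝔭) = 3`
  haveI := h𝔭.1
  haveI := h𝔭.2
  have hsplit := ncard_primesOver_three_eq_two_of_discr_eq_neg_eight hK hdK
  obtain ⟨-, hf⟩ := SplitPrime.ramificationIdx_eq_one_of_ncard_primesOver Nat.prime_three
    (hsplit.trans h2.symm) h𝔭
  have hN𝔭 : Ideal.absNorm 𝔭 = 3 := by
    rw [Ideal.absNorm_eq_pow_inertiaDeg' 𝔭 Nat.prime_three, hf, pow_one]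
  have hNα : (Algebra.norm ℤ α).natAbs = 3 := by
    rw [← Ideal.absNorm_span_singleton, hα, hN𝔭]
  -- coordinates and the norm form `u² + 2v²`
  obtain ⟨u, v, huv⟩ := T.exists_int_coords α
  have hτK : ((T.τ : 𝓞 K) : K) * ((T.τ : 𝓞 K) : K) = (T.m : K) + (T.ε : K) * ((T.τ : 𝓞 K) : K) := by
    have := congrArg (algebraMap (𝓞 K) K) T.τ_sq
    simp only [map_mul, map_add, map_intCast] at this
    rw [← RingOfIntegers.coe_eq_algebraMap] at this
    exact this
  have hαK : ((α : 𝓞 K) : K) = (u : K) + (v : K) * ((T.τ : 𝓞 K) : K) := by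
    rw [huv]; push_cast; rfl
  have hnormK : ((Algebra.norm ℤ α : ℤ) : K) = ((u ^ 2 + 2 * v ^ 2 : ℤ) : K) := by
    rw [T.coe_norm h2 α, T.σ_coe_of_coords h2 huv, hαK, hε, hm] at *
    push_cast
    rw [hε, hm] at hτK
    push_cast at hτK
    linear_combination (-(v : K) ^ 2) * hτK
  have hnorm : Algebra.norm ℤ α = u ^ 2 + 2 * v ^ 2 := by exact_mod_cast hnormK
  have h3 : u ^ 2 + 2 * v ^ 2 = 3 := by
    have h0 : 0 ≤ u ^ 2 + 2 * v ^ 2 := by positivity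
    have h1 : (u ^ 2 + 2 * v ^ 2).natAbs = 3 := by rw [← hnorm, hNα]
    have := Int.natAbs_of_nonneg h0
    rw [h1] at this
    exact_mod_cast this.symm
  have hv1 : v ≤ 1 := by nlinarith
  have hv2 : -1 ≤ v := by nlinarith
  have hu1 : u ≤ 1 := by nlinarith
  have hu2 : -1 ≤ u := by nlinarith
  refine ⟨u, v, huv, ?_, ?_, hε, hm⟩
  · interval_cases v <;> interval_cases u <;> omega
  · interval_cases v <;> interval_cases u <;> omega

/-- **The non-trivial automorphism of a quadratic field is the conjugation** of the integral-basis
datum: `τ ≠ 1 ⟹ τ = σ` (`#Aut(K/ℚ) = [K : ℚ] = 2`, and `σ s = −s ≠ s`). [cite: Marcus2018, Ch. 2 Thm. 1] -/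
theorem algEquiv_apply_eq_σ (h2 : Module.finrank ℚ K = 2) (T : TauData K) (τ : K ≃ₐ[ℚ] K)
    (hτ : τ ≠ 1) (x : K) : τ x = T.σ h2 x := by
  set c : K →ₐ[ℚ] K := conj h2 (T.s_not_mem_range h2) T.sq_s_algebraMap with hc
  have hcc : c.comp c = AlgHom.id ℚ K := by
    ext y
    exact conj_conj h2 (T.s_not_mem_range h2) T.sq_s_algebraMap y
  set σ' : K ≃ₐ[ℚ] K := AlgEquiv.ofAlgHom c c hcc hcc with hσ'
  have hσ'apply : ∀ y, σ' y = T.σ h2 y := fun y => rfl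
  have hs0 : ((T.s : 𝓞 K) : K) ≠ 0 := by
    intro h0
    have := T.sq_s
    rw [h0, zero_pow two_ne_zero] at this
    have hd : (NumberField.discr K : K) = 0 := this.symm
    exact NumberField.discr_ne_zero K (by exact_mod_cast hd)
  have hσ'1 : σ' ≠ 1 := by
    intro h
    have h1 : σ' ((T.s : 𝓞 K) : K) = (T.s : K) := by rw [h]; rfl
    rw [hσ'apply, T.σ_s] at h1
    exact hs0 (by linear_combination (-1 / 2 : K) * h1)
  haveI : Algebra.IsQuadraticExtension ℚ K := ⟨h2⟩
  have hcard : Nat.card (K ≃ₐ[ℚ] K) = 2 := by rw [IsGalois.card_aut_eq_finrank, h2]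
  obtain ⟨y, -, hy⟩ := (Nat.card_eq_two_iff' (1 : K ≃ₐ[ℚ] K)).mp hcard
  rw [(hy τ hτ).trans (hy σ' hσ'1).symm, hσ'apply]

/-! ## §3 Hypothesis (4) of Kriz–Li Thm. 7.1 (ψ = 1) at `p = 3`, `d_K = −8` -/

/-- **Kriz–Li Thm. 7.1 (4) for `K = ℚ(√−2)`, `p = 3`**: for every imaginary quadratic `K` with
`d_K = −8`, every `ιp : K → ℚ₃`, prime `𝔭 ∣ 3` under `ιp`, generator `(α) = 𝔭^{h_K}` and `τ ≠ 1`: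
`‖((3 − 1)/(2·3)) · log₃ ιp(τ α)‖ = 1`. (§2: `h_K = 1`, `α = u + v√−2` with `u² = v² = 1`,
`α·τα = 3`, `α + τα = 2u`; `‖ιp α‖ < 1`; then §1.) The p3 g2 class theorem displayed exactly this.
[cite: KrizLi2019, Thm. 7.1 second alternative, hypothesis (4) (p. 43)] -/
theorem thm71_four_of_discr_eq_neg_eight (hK : IsImaginaryQuadratic K)
    (hdK : NumberField.discr K = -8) (ιp : K →+* ℚ_[3]) (𝔭 : Ideal (𝓞 K)) (α : 𝓞 K)
    (τ : K ≃ₐ[ℚ] K) (h𝔭 : 𝔭 ∈ (Ideal.span {((3 : ℕ) : ℤ)}).primesOver (𝓞 K))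
    (hιp : ∀ x : 𝓞 K, x ∈ 𝔭 → ‖ιp x‖ < 1)
    (hα : Ideal.span {α} = 𝔭 ^ NumberField.classNumber K) (hτ : τ ≠ 1) :
    ‖(((3 : ℕ) : ℚ_[3]) - 1) / (2 * (3 : ℕ)) * padicLog 3 (ιp (τ (α : K)))‖ = 1 := by
  have h2 := hK.1
  obtain ⟨T⟩ := nonempty_tauData (K := K) h2
  rw [classNumber_eq_one_of_discr_eq_neg_eight hK hdK, pow_one] at hα
  obtain ⟨u, v, huv, hu, hv, hε, hm⟩ := exists_coords_of_span_eq_prime_three hK hdK T h𝔭 hα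
  -- `τ α = σ α = u − vτ`
  have hτσ : τ (α : K) = T.σ h2 (α : K) := algEquiv_apply_eq_σ h2 T τ hτ _
  have hσα : T.σ h2 (α : K) = (u : K) - (v : K) * ((T.τ : 𝓞 K) : K) := by
    rw [T.σ_coe_of_coords h2 huv, hε]; push_cast; ring
  have hαK : ((α : 𝓞 K) : K) = (u : K) + (v : K) * ((T.τ : 𝓞 K) : K) := by
    rw [huv]; push_cast; rfl
  -- `α · σα = N(α) = u² + 2v² = 3`
  have hτK : ((T.τ : 𝓞 K) : K) * ((T.τ : 𝓞 K) : K) = (T.m : K) + (T.ε : K) * ((T.τ : 𝓞 K) : K) := by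
    have := congrArg (algebraMap (𝓞 K) K) T.τ_sq
    simp only [map_mul, map_add, map_intCast] at this
    rw [← RingOfIntegers.coe_eq_algebraMap] at this
    exact this
  rw [hε, hm] at hτK
  push_cast at hτK
  have huK : (u : K) ^ 2 = 1 := by exact_mod_cast hu
  have hvK : (v : K) ^ 2 = 1 := by exact_mod_cast hv
  have hprodK : ((α : 𝓞 K) : K) * T.σ h2 (α : K) = 3 := by
    rw [hσα, hαK]
    linear_combination (-(v : K) ^ 2) * hτK + huK + 2 * hvK
  have hsumK : ((α : 𝓞 K) : K) + T.σ h2 (α : K) = 2 * (u : K) := by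
    rw [hσα, hαK]; ring
  -- transport to `ℚ₃`
  have hsum : ιp (α : K) + ιp (τ (α : K)) = 2 * (u : ℚ_[3]) := by
    rw [hτσ, ← map_add, hsumK, map_mul, map_intCast, map_ofNat]
  have hprod : ιp (α : K) * ιp (τ (α : K)) = 3 := by
    rw [hτσ, ← map_mul, hprodK, map_ofNat]
  have hT : (2 * (u : ℚ_[3])) ^ 2 = 4 := by
    have : (u : ℚ_[3]) ^ 2 = 1 := by exact_mod_cast hu
    linear_combination 4 * this
  have ha : ‖ιp (α : K)‖ < 1 := hιp α (by rw [← hα]; exact Ideal.mem_span_singleton_self α)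
  exact norm_third_mul_padicLog_eq_one_of_trace_norm hT hsum hprod ha

/-! ## §4 The `243a` class theorem with the Heegner field `ℚ(√−2)`: (4) discharged -/

/-- **BSD₃ for the class `243a` shape (`j = 0`, `d* = 1`, `N = 3^a`) with a Heegner field of
discriminant `−8`, Kriz–Li Thm. 7.1 (ψ = 1) hypothesis (4) IN THE KERNEL.** p3 g2's
`bsdp_three_of_thm71_trivialChar` with `K` any imaginary quadratic field of `d_K = −8` (`≅ ℚ(√−2)`):
`d_K < −4`, `3` split in `K`, the generator `α` of `𝔭^{h_K} = 𝔭`, the automorphism `τ ≠ 1` and the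
`ᾱ`-certificate `‖((3−1)/(2·3))·log₃ ιp(τα)‖ = 1` are all DISCHARGED / CONSTRUCTED here
(`thm71_four_of_discr_eq_neg_eight`); what stays displayed is Route U's data `(D, H, ι, ιp, P, hP)`,
the PUB facts, `r_an = 1`, `L(W^{(−8)}, 1) ≠ 0`, the twin's 3-part, `3 ∤ ∏ c_ℓ`, `3 ∤ #Ш`, the
level-`0` generator, the two Kriz–Li named facts, and `(𝔭, h𝔭, hιp)` = "`𝔭` is the prime of `K` under
`ιp`". Reach: `243a` (`x³ + y³ = 9`; regime T, item stmt-BirchSwinnertonDyer-20699).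
[cite: KrizLi2019, Thm. 7.1 second alternative (pp. 42–43), Rem. 7.2 (p. 43), Rem. 3.10 (p. 26)]
[cite: GrossZagier1986, V.§2 (pp. 310–312)] [cite: Miller2011LMS, Def. 1.1] -/
theorem bsdp_three_of_thm71_trivialChar_discr_neg_eight
    (hKL71 : KrizLi2019.thm71_padicLogHeegner_unit_of_trivialChar)
    (hRem : KrizLi2019.rem310_padicLogHeegner_integral)
    (W : WeierstrassCurve ℚ) [W.IsElliptic] [W.IsGloballyMinimal] [NeZero (W.conductorNorm ℤ)]
    -- the Mordell datum (`d* = 1`) and the per-curve one-liners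
    {d m : ℤ} (hd : d = 1 ∨ d = -3) (hm : m ≠ 0)
    (hW : ∃ C : VariableChange ℚ, C • W = mordellCurve ((d : ℚ) * (m : ℚ) ^ 2))
    (h6 : ∀ ℓ : ℕ, ℓ.Prime → ¬ ((ℓ : ℤ) ^ 6 ∣ d * m ^ 2))
    (h2 : (haveI : Fact (Nat.Prime 2) := ⟨Nat.prime_two⟩; W.HasGoodReductionAtPrime 2) →
      W.LFunction 2 = 0)
    (hS : ∀ ℓ : ℕ, (hℓ : ℓ.Prime) → ¬ (haveI := Fact.mk hℓ; W.HasGoodReductionAtPrime ℓ) → ℓ = 3)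
    -- the Heegner field `K ≅ ℚ(√−2)` and Route U's data / PUB facts
    (K : Type) [Field K] [NumberField K] [NeZero (NumberField.discr K).natAbs]
    (hK : IsImaginaryQuadratic K) (hdK : NumberField.discr K = -8)
    (D : ModularParametrizationData W (W.conductorNorm ℤ))
    (H : HeegnerDatum (W.conductorNorm ℤ) (NumberField.discr K)) (ι : K →+* ℂ)
    (ιp : K →+* ℚ_[3]) (P : (W.baseChange K).toAffine.Point)
    (hGZ : gross_zagier (W.conductorNorm ℤ) W K) (hKo : kolyvagin (W.conductorNorm ℤ) W K)
    (hGZK : rank_eq_analyticRank_of_analyticRank_le_one) (hmod : hasEntireLFunction_rat)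
    (hP : WeierstrassCurve.Affine.Point.map ι.toRatAlgHom P = heegnerPointComplex D H)
    (hr : W.analyticRank = 1)
    (hLt : (W.quadraticTwist (NumberField.discr K : ℚ)).entireLFunction 1 ≠ 0)
    (Wd : WeierstrassCurve ℚ) [Wd.IsElliptic] [Wd.IsGloballyMinimal] (Cd : VariableChange ℚ)
    (hWd : Cd • W.quadraticTwist (NumberField.discr K : ℚ) = Wd)
    (htw : ∃ q : ℚ, Wd.entireLFunction 1 / (Wd.realPeriodRat : ℂ) = (q : ℂ) ∧
      padicValRat 3 q = (padicValNat 3 Wd.shaOrder : ℤ) + padicValNat 3 Wd.tamagawaProduct -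
        2 * padicValNat 3 Wd.torsionOrder)
    (htam : padicValNat 3 Wd.tamagawaProduct = padicValNat 3 W.tamagawaProduct)
    (hu : padicValRat 3 (Cd.u : ℚ) = 0)
    (htamW : ¬ 3 ∣ W.tamagawaProduct)
    (hSW : ∀ [Finite W.sha], ¬ 3 ∣ W.shaOrder) (hSd : ∀ [Finite Wd.sha], ¬ 3 ∣ Wd.shaOrder)
    -- `𝔭` = the prime of `K` under `ιp` (canonical data; the (4)-certificate itself is PROVED)
    (𝔭 : Ideal (𝓞 K)) (h𝔭 : 𝔭 ∈ (Ideal.span {((3 : ℕ) : ℤ)}).primesOver (𝓞 K))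
    (hιp : ∀ x : 𝓞 K, x ∈ 𝔭 → ‖ιp x‖ < 1)
    -- a Teichmüller character mod 3 and T-U2's level-0 generator data
    (ω : DirichletCharacter ℚ_[3] 3) (hω : KrizLi2019.IsTeichmullerCharacter ω)
    [Finite (AddCommGroup.torsion (W.baseChange K).toAffine.Point)]
    (crd : (W.baseChange K).toAffine.Point →+ ℤ) (g : (W.baseChange K).toAffine.Point)
    (hg : crd g = 1) (hker : ∀ x, crd x = 0 → IsOfFinAddOrder x)
    (hiv : ∀ x : (W.baseChange K).toAffine.Point, 3 • x = 0 → x = 0)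
    (hg0 : ‖Castella2018.padicLogOmega W 3 ιp g‖ = 1) :
    BSDp W 3 := by
  have hq2 := hK.1
  -- `h_K = 1`: `𝔭` is principal
  have h1 : NumberField.classNumber K = 1 := classNumber_eq_one_of_discr_eq_neg_eight hK hdK
  haveI : IsPrincipalIdealRing (𝓞 K) := NumberField.classNumber_eq_one_iff.mp h1
  obtain ⟨α, hα⟩ := (IsPrincipalIdealRing.principal 𝔭).principal
  have hα' : Ideal.span {α} = 𝔭 ^ NumberField.classNumber K := by
    rw [h1, pow_one, hα]
  -- the non-trivial automorphism
  haveI : Algebra.IsQuadraticExtension ℚ K := ⟨hq2⟩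
  have hcard : Nat.card (K ≃ₐ[ℚ] K) = 2 := by rw [IsGalois.card_aut_eq_finrank, hq2]
  obtain ⟨τ, hτ, -⟩ := (Nat.card_eq_two_iff' (1 : K ≃ₐ[ℚ] K)).mp hcard
  exact bsdp_three_of_thm71_trivialChar hKL71 hRem W hd hm hW h6 h2 hS K hK (by rw [hdK]; norm_num)
    (ncard_primesOver_three_eq_two_of_discr_eq_neg_eight hK hdK) D H ι ιp P hGZ hKo hGZK hmod hP hr
    hLt Wd Cd hWd htw htam hu htamW hSW hSd 𝔭 α τ h𝔭 hιp hα' hτ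
    (thm71_four_of_discr_eq_neg_eight hK hdK ιp 𝔭 α τ h𝔭 hιp hα' hτ) ω hω crd g hg hker hiv hg0

end MinusEight

end Summit.BirchSwinnertonDyer.BirchSwinnertonDyer.Theorems.PrintCFram

end
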